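import Literature.Topology.FourManifolds.LatticeFormsTransvectionsStableSpecialOrthogonal
import Literature.Topology.FourManifolds.LatticeFormsOrthogonalGroupGeneration
import Literature.Topology.FourManifolds.LatticeFormsOrientationCharacterRestriction
import HarnessLib
import Literature.Topology.FourManifolds.LatticeFormsDiscriminantFormIsometryOrthoSum

/-!
# `Õ⁺(L) = ⟨E_U(L₁), Õ⁺(L₁)⟩`, and similarly for `O⁺`, `SO`, `S̃O⁺`: in the factorisation `φ = (ψ ⊕ 1)·A_a·w` of
# `O(Q ⊕ H)` the Eichler part lies in `S̃O⁺` (Gritsenko–Hulek–Sankaran, *J. Algebra* 322 (2009) §3, after Prop. 3.3)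

Trunk T-4MAN vocabulary. Sequel of `LatticeFormsOrthogonalGroupGeneration.lean` (GHS 2009 Prop. 3.3 (iii) /
Wall 1963 in Kirby's vocabulary: every isometry `φ` of `Q ⊕ H`, `Q` symmetric even with a hyperbolic pair, factors as
`φ = ((ψ ⊕ 1_H) · A_a) · w` with `ψ ∈ O(Q)`, `A_a` a Kirby transvection and `w = UGen.evalEquiv l` an admissible word in
the Eichler transvections `E(y,b,q)`, `E(x,b,q)`), of `LatticeFormsTransvectionsStableSpecialOrthogonal.lean` (row g48-#8:
every Eichler transvection lies in `S̃O⁺ = Õ ∩ O⁺ ∩ SO`) and of `LatticeFormsOrientationCharacterRestriction.lean`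
(`ψ ⊕ 1 ∈ O⁺ ⟺ ψ ∈ O⁺`). Written for lane `lit-hodgefound` (Track 2 foundations; prover seat `lit-hodgefound-p18`,
gen 48, row g48-#10). THEOREMS ONLY — no definition, no named fact, no instance, no notation.

## Source, verbatim

V. Gritsenko, K. Hulek, G. K. Sankaran, *Abelianisation of orthogonal groups and the fundamental group of modular
varieties*, J. Algebra 322 (2009) [`GritsenkoHulekSankaran2009`, held `paper:arxiv-0810.1614`, §3 p. 7]:
"**Proposition 3.3.** Let `L = U ⊕ U₁ ⊕ L₀`, where `U = ℤe ⊕ ℤf`, `U₁` is the second copy of the integral hyperbolic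
plane in `L` and `L₁ = U₁ ⊕ L₀`. […] (iii) `O(L) = ⟨E_U(L₁), O(L₁)⟩`. […] *Proof.* (iii) Let `g ∈ O(L)`. According to
(i) and (ii) there exists `τ ∈ E_U(L₁)` such that `τ(g(e)) = e`. […] Therefore `(τ g)(f) = f + b − ½(b,b)e = t(e,b)(f)`
[…] □ Notice that (iii) is true for all the groups we have considered: for instance,
`Õ⁺(L) = ⟨E_U(L₁), Õ⁺(L₁)⟩` and similarly for `SO`, `S̃O`, etc.. This is because in the proof of (iii) the product
`t(e,−b)τ ∈ S̃O⁺(L)`, which is a subgroup of all of these groups."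

## Contents (all proved) and reading notes

* GROUPS: as in the sibling files no subgroup is formed; "`γ ∈ Õ`" is `γ̄ = id` (`discriminantGroupCongr = refl`),
  "`γ ∈ O⁺`" is `IsOrientationPreserving`, "`γ ∈ SO`" is `det γ = 1`; the tree's `L = Q ⊕ H` has `U = H` (the LAST
  summand, Kirby's convention) and `L₁ = Q ⊇ U₁`.
* §1 **Admissible Eichler words lie in `S̃O⁺(Q ⊕ H)`** (`UGen.toIsometryEquiv_mem_stableSpecialOrthogonal`,
  `UGen.evalEquiv_mem_stableSpecialOrthogonal`), and `S̃O⁺` is closed under composition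
  (`mem_stableSpecialOrthogonal_trans`).
* §2 `det (ψ ⊕ 1_H) = det ψ` (`IsometryEquiv.det_prodCongr_refl`).
* §3 **The factorisation with its `S̃O⁺` part**: `φ = (ψ ⊕ 1) · ρ` with `ρ = A_a · w ∈ S̃O⁺(Q ⊕ H)`
  (`exists_eq_prodCongr_refl_trans_of_mem_stableSpecialOrthogonal`); consequently for such a factorisation
  `φ ∈ O⁺ ⟺ ψ ∈ O⁺(Q)`, `φ̄ = id ⟺ (ψ ⊕ 1)‾ = id`, `det φ = det ψ` (`…_iff_of_eq_prodCongr_refl_trans`), and the printed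
  "**`Õ⁺(L) = ⟨E_U(L₁), Õ⁺(L₁)⟩` and similarly for `SO`, `S̃O`**": every `φ ∈ Õ⁺(Q ⊕ H)` (resp. `SO⁺`, `S̃O⁺`, `O⁺`) is
  `(ψ ⊕ 1) · ρ` with `ψ ⊕ 1` in the same group and `ρ ∈ S̃O⁺` a product of Eichler transvections
  (`exists_eq_prodCongr_refl_trans_of_congr_eq_refl_of_isOrientationPreserving` and companions). The condition on
  `ψ ⊕ 1` is stated on `Q ⊕ H`; for `O⁺` and `det` it is transferred to `ψ` on `Q` (§2 and the Restriction file); for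
  `γ̄` the identification `A_{Q ⊕ H} = A_Q` (`H` unimodular) is §4.
* §4 (gen 49, row g49-#3) **The conditions read on `ψ ∈ O(L₁)` itself**: with `(ψ ⊕ 1)‾ = id ⟺ ψ̄ = id`
  (`LatticeFormsDiscriminantFormIsometryOrthoSum.lean`: `(α ⊥ β)‾ = ᾱ ⊕ β̄` under `A_{Λ₁ ⊕ Λ₂} = A_{Λ₁} ⊕ A_{Λ₂}`),
  `ψ ⊕ 1 ∈ S̃O⁺(Q ⊕ H) ⟺ ψ ∈ S̃O⁺(Q)` (`prodCongr_refl_mem_stableSpecialOrthogonal_iff`), for `φ = (ψ ⊕ 1) · ρ` with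
  `ρ ∈ S̃O⁺`: `φ̄ = id ⟺ ψ̄ = id`, `φ ∈ S̃O⁺ ⟺ ψ ∈ S̃O⁺(Q)` (`…_iff_of_eq_prodCongr_refl_trans'`,
  `mem_stableSpecialOrthogonal_iff_of_eq_prodCongr_refl_trans`), and the printed
  "**`Õ⁺(L) = ⟨E_U(L₁), Õ⁺(L₁)⟩`**, **`S̃O⁺(L) = ⟨E_U(L₁), S̃O⁺(L₁)⟩`**" with `ψ ∈ Õ⁺(Q)` resp. `ψ ∈ S̃O⁺(Q)`
  (`exists_eq_prodCongr_refl_trans_of_congr_eq_refl_of_isOrientationPreserving'`,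
  `exists_eq_prodCongr_refl_trans_of_mem_stableSpecialOrthogonal''`) and their converses
  (`congr_eq_refl_and_isOrientationPreserving_prodCongr_refl_trans`, `prodCongr_refl_trans_mem_stableSpecialOrthogonal`).
-/

noncomputable section

open Module
open LinearMap (BilinForm)
open LinearMap.BilinForm
open LinearMap.BilinForm (IsometryEquiv)
open Literature.LinearAlgebra.QuadraticForm

namespace Literature.Topology.FourManifolds

universe u

/-! ### §1 Admissible Eichler words lie in `S̃O⁺` -/

section Words

variable {W : Type u} [AddCommGroup W] [Module.Finite ℤ W] [Module.Free ℤ W] {B : BilinForm ℤ W} {x y : W}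

omit [Module.Finite ℤ W] [Module.Free ℤ W] in
/-- `det (γσ) = det σ · det γ` (plumbing). [folklore] -/
private theorem det_trans (γ σ : B.IsometryEquiv B) :
    LinearMap.det ((γ.trans σ : B.IsometryEquiv B) : W →ₗ[ℤ] W) =
      LinearMap.det (σ : W →ₗ[ℤ] W) * LinearMap.det (γ : W →ₗ[ℤ] W) := by
  rw [show ((γ.trans σ : B.IsometryEquiv B) : W →ₗ[ℤ] W) = (σ : W →ₗ[ℤ] W) ∘ₗ (γ : W →ₗ[ℤ] W) from
    LinearMap.ext fun _ ↦ rfl, LinearMap.det_comp]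

/-- **`S̃O⁺(L)` is closed under composition** ("`S̃O⁺(L)`, which is a subgroup"): `γ̄ = id`, `O⁺`, `det = 1` pass to
`γσ` (`B` symmetric non-degenerate). [cite: GritsenkoHulekSankaran2009, §3 ("t(e,−b)τ ∈ S̃O⁺(L), which is a subgroup of all of these groups")] -/
theorem mem_stableSpecialOrthogonal_trans (hB : B.IsSymm) (hnd : B.Nondegenerate) {γ σ : B.IsometryEquiv B}
    (hγ : γ.discriminantGroupCongr = LinearEquiv.refl ℤ B.discriminantGroup ∧ γ.IsOrientationPreserving ∧
      LinearMap.det (γ : W →ₗ[ℤ] W) = 1)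
    (hσ : σ.discriminantGroupCongr = LinearEquiv.refl ℤ B.discriminantGroup ∧ σ.IsOrientationPreserving ∧
      LinearMap.det (σ : W →ₗ[ℤ] W) = 1) :
    (γ.trans σ).discriminantGroupCongr = LinearEquiv.refl ℤ B.discriminantGroup ∧ (γ.trans σ).IsOrientationPreserving ∧
      LinearMap.det ((γ.trans σ : B.IsometryEquiv B) : W →ₗ[ℤ] W) = 1 := by
  refine ⟨?_, ?_, ?_⟩
  · rw [LinearMap.BilinForm.IsometryEquiv.discriminantGroupCongr_trans, hγ.1, hσ.1, LinearEquiv.trans_refl]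
  · exact (LinearMap.BilinForm.IsometryEquiv.isOrientationPreserving_trans_iff hB hnd γ σ).2 (iff_of_true hσ.2.1 hγ.2.1)
  · rw [det_trans, hγ.2.2, hσ.2.2, mul_one]

/-- `id ∈ S̃O⁺(L)`. [cite: GritsenkoHulekSankaran2009, §3] -/
theorem refl_mem_stableSpecialOrthogonal :
    (LinearMap.BilinForm.IsometryEquiv.refl B).discriminantGroupCongr = LinearEquiv.refl ℤ B.discriminantGroup ∧
      (LinearMap.BilinForm.IsometryEquiv.refl B).IsOrientationPreserving ∧
      LinearMap.det ((LinearMap.BilinForm.IsometryEquiv.refl B : B.IsometryEquiv B) : W →ₗ[ℤ] W) = 1 := by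
  refine ⟨LinearMap.BilinForm.IsometryEquiv.discriminantGroupCongr_refl,
    LinearMap.BilinForm.IsometryEquiv.IsOrientationPreserving.refl, ?_⟩
  rw [show ((LinearMap.BilinForm.IsometryEquiv.refl B : B.IsometryEquiv B) : W →ₗ[ℤ] W) = LinearMap.id from
    LinearMap.ext fun _ ↦ rfl, LinearMap.det_id]

/-- **An admissible generator `E(y,a,q)` / `E(x,a,q)` lies in `S̃O⁺`** (it is an Eichler transvection; `B` symmetric
non-degenerate). [cite: GritsenkoHulekSankaran2009, §3.1 (8) and §3 ("E(L) […] is a subgroup of S̃O⁺(L)")] -/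
theorem UGen.toIsometryEquiv_mem_stableSpecialOrthogonal (hB : B.IsSymm) (hnd : B.Nondegenerate) (hxx : B x x = 0)
    (hyy : B y y = 0) (g : UGen W) (hg : g.IsAdmissible B x y) :
    (UGen.toIsometryEquiv hB hxx hyy g hg).discriminantGroupCongr = LinearEquiv.refl ℤ B.discriminantGroup ∧
      (UGen.toIsometryEquiv hB hxx hyy g hg).IsOrientationPreserving ∧
      LinearMap.det ((UGen.toIsometryEquiv hB hxx hyy g hg : B.IsometryEquiv B) : W →ₗ[ℤ] W) = 1 := by
  cases g with
  | atY a q =>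
    exact LinearMap.BilinForm.IsometryEquiv.eichlerTransvection_mem_stableSpecialOrthogonal B hB hnd y a q hyy hg.2.1
      hg.2.2
  | atX a q =>
    exact LinearMap.BilinForm.IsometryEquiv.eichlerTransvection_mem_stableSpecialOrthogonal B hB hnd x a q hxx hg.1
      hg.2.2

/-- **An admissible word `w ∈ E_U` lies in `S̃O⁺`** (`B` symmetric non-degenerate).
[cite: GritsenkoHulekSankaran2009, §3 ("E(L) […] is a subgroup of S̃O⁺(L)"; E_U(L₁) = ⟨t(e,a), t(f,a)⟩)] -/
theorem UGen.evalEquiv_mem_stableSpecialOrthogonal (hB : B.IsSymm) (hnd : B.Nondegenerate) (hxx : B x x = 0)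
    (hyy : B y y = 0) (l : List (UGen W)) (hl : ∀ g ∈ l, g.IsAdmissible B x y) :
    (UGen.evalEquiv hB hxx hyy l hl).discriminantGroupCongr = LinearEquiv.refl ℤ B.discriminantGroup ∧
      (UGen.evalEquiv hB hxx hyy l hl).IsOrientationPreserving ∧
      LinearMap.det ((UGen.evalEquiv hB hxx hyy l hl : B.IsometryEquiv B) : W →ₗ[ℤ] W) = 1 := by
  induction l with
  | nil => exact refl_mem_stableSpecialOrthogonal
  | cons g l ih =>
    exact mem_stableSpecialOrthogonal_trans hB hnd (ih fun g' hg' ↦ hl g' (List.mem_cons_of_mem g hg'))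
      (UGen.toIsometryEquiv_mem_stableSpecialOrthogonal hB hnd hxx hyy g (hl g List.mem_cons_self))

end Words

/-! ### §2 `det (ψ ⊕ 1) = det ψ` -/

section Prod

variable {V : Type*} [AddCommGroup V] [Module.Finite ℤ V] [Module.Free ℤ V] {Q : BilinForm ℤ V}
  {F : Type*} [AddCommGroup F] [Module.Finite ℤ F] [Module.Free ℤ F] {R : BilinForm ℤ F}

/-- **`det (ψ ⊕ 1) = det ψ`.** [cite: GritsenkoHulekSankaran2009, §3 ("similarly for SO")] -/
theorem IsometryEquiv.det_prodCongr_refl (ψ : Q.IsometryEquiv Q) :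
    LinearMap.det ((LinearMap.BilinForm.IsometryEquiv.prodCongr ψ (LinearMap.BilinForm.IsometryEquiv.refl R) :
        (Q.prod R).IsometryEquiv (Q.prod R)) : V × F →ₗ[ℤ] V × F) = LinearMap.det (ψ : V →ₗ[ℤ] V) := by
  rw [show ((LinearMap.BilinForm.IsometryEquiv.prodCongr ψ (LinearMap.BilinForm.IsometryEquiv.refl R) :
        (Q.prod R).IsometryEquiv (Q.prod R)) : V × F →ₗ[ℤ] V × F) = (ψ : V →ₗ[ℤ] V).prodMap LinearMap.id from
      LinearMap.ext fun _ ↦ rfl, LinearMap.det_prodMap, LinearMap.det_id, mul_one]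

end Prod

/-! ### §3 The factorisation of `O(Q ⊕ H)` with its `S̃O⁺` part -/

section Factorisation

variable {V : Type u} [AddCommGroup V] [Module.Finite ℤ V] [Module.Free ℤ V] {Q : BilinForm ℤ V}

/-- **`φ = (ψ ⊕ 1) · ρ` with `ρ ∈ S̃O⁺(Q ⊕ H)`**: for `Q` symmetric even with a hyperbolic pair `x₁, y₁` and `Q ⊕ H`
non-degenerate, every isometry `φ` of `Q ⊕ H` is `ψ ⊕ 1_H` (`ψ ∈ O(Q)`) followed by `ρ = A_a · w`, a product of Eichler
transvections, which acts trivially on the discriminant group, preserves the orientation and has determinant `1` —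
"in the proof of (iii) the product `t(e,−b)τ ∈ S̃O⁺(L)`". [cite: GritsenkoHulekSankaran2009, §3 Prop. 3.3 (iii) and the remark after its proof] -/
theorem exists_eq_prodCongr_refl_trans_of_mem_stableSpecialOrthogonal (hQ : Q.IsSymm) (hev : Q.IsEven)
    (hnd : (Q.prod hyperbolicForm).Nondegenerate) {x₁ y₁ : V} (hx₁ : Q x₁ x₁ = 0) (hy₁ : Q y₁ y₁ = 0)
    (hx₁y₁ : Q x₁ y₁ = 1) (φ : (Q.prod hyperbolicForm).IsometryEquiv (Q.prod hyperbolicForm)) :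
    ∃ (ψ : Q.IsometryEquiv Q) (ρ : (Q.prod hyperbolicForm).IsometryEquiv (Q.prod hyperbolicForm)),
      φ = (LinearMap.BilinForm.IsometryEquiv.prodCongr ψ (LinearMap.BilinForm.IsometryEquiv.refl hyperbolicForm)).trans ρ ∧
      ρ.discriminantGroupCongr = LinearEquiv.refl ℤ _ ∧ ρ.IsOrientationPreserving ∧
      LinearMap.det (ρ : V × (Fin 2 → ℤ) →ₗ[ℤ] V × (Fin 2 → ℤ)) = 1 := by
  obtain ⟨l, hl, a, q, hq, ψ, hφ⟩ :=
    exists_eq_prodCongr_trans_transvectionAEquiv_trans_evalEquiv hQ hev hx₁ hy₁ hx₁y₁ φ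
  have hB : (Q.prod hyperbolicForm).IsSymm := hQ.prod isSymm_hyperbolicForm
  refine ⟨ψ, (transvectionAEquiv hQ a q hq).trans (UGen.evalEquiv hB (prod_hyperbolic_hypX_hypX Q)
    (prod_hyperbolic_hypY_hypY Q) l hl), ?_, ?_⟩
  · rw [hφ]
    rfl
  · exact mem_stableSpecialOrthogonal_trans hB hnd (transvectionAEquiv_mem_stableSpecialOrthogonal hQ hnd a q hq)
      (UGen.evalEquiv_mem_stableSpecialOrthogonal hB hnd (prod_hyperbolic_hypX_hypX Q) (prod_hyperbolic_hypY_hypY Q)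
        l hl)

variable {φ ρ : (Q.prod hyperbolicForm).IsometryEquiv (Q.prod hyperbolicForm)} {ψ : Q.IsometryEquiv Q}

/-- **`φ ∈ O⁺(Q ⊕ H) ⟺ ψ ∈ O⁺(Q)`** for `φ = (ψ ⊕ 1) · ρ`, `ρ ∈ O⁺` (`Q` symmetric, `Q` and `Q ⊕ H` non-degenerate).
[cite: GritsenkoHulekSankaran2009, §3 (remark after Prop. 3.3: "Õ⁺(L) = ⟨E_U(L₁), Õ⁺(L₁)⟩")] -/
theorem isOrientationPreserving_iff_of_eq_prodCongr_refl_trans (hQ : Q.IsSymm) (hndQ : Q.Nondegenerate)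
    (hnd : (Q.prod hyperbolicForm).Nondegenerate)
    (h : φ = (LinearMap.BilinForm.IsometryEquiv.prodCongr ψ (LinearMap.BilinForm.IsometryEquiv.refl hyperbolicForm)).trans ρ)
    (hρ : ρ.IsOrientationPreserving) : φ.IsOrientationPreserving ↔ ψ.IsOrientationPreserving := by
  rw [h, LinearMap.BilinForm.IsometryEquiv.isOrientationPreserving_trans_iff (hQ.prod isSymm_hyperbolicForm) hnd,
    LinearMap.BilinForm.IsometryEquiv.isOrientationPreserving_prodCongr_refl_iff hQ hndQ isSymm_hyperbolicForm
      isUnimodular_hyperbolicForm_holds.nondegenerate]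
  exact ⟨fun H ↦ H.1 hρ, fun H ↦ iff_of_true hρ H⟩

omit [Module.Finite ℤ V] [Module.Free ℤ V] in
/-- **`φ̄ = id ⟺ (ψ ⊕ 1)‾ = id`** for `φ = (ψ ⊕ 1) · ρ`, `ρ̄ = id`.
[cite: GritsenkoHulekSankaran2009, §3 (remark after Prop. 3.3: "Õ⁺(L) = ⟨E_U(L₁), Õ⁺(L₁)⟩")] -/
theorem discriminantGroupCongr_eq_refl_iff_of_eq_prodCongr_refl_trans
    (h : φ = (LinearMap.BilinForm.IsometryEquiv.prodCongr ψ (LinearMap.BilinForm.IsometryEquiv.refl hyperbolicForm)).trans ρ)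
    (hρ : ρ.discriminantGroupCongr = LinearEquiv.refl ℤ _) :
    φ.discriminantGroupCongr = LinearEquiv.refl ℤ _ ↔
      (LinearMap.BilinForm.IsometryEquiv.prodCongr ψ (LinearMap.BilinForm.IsometryEquiv.refl hyperbolicForm) :
        (Q.prod hyperbolicForm).IsometryEquiv (Q.prod hyperbolicForm)).discriminantGroupCongr = LinearEquiv.refl ℤ _ := by
  rw [h, LinearMap.BilinForm.IsometryEquiv.discriminantGroupCongr_trans, hρ, LinearEquiv.trans_refl]

/-- **`det φ = det ψ`** for `φ = (ψ ⊕ 1) · ρ`, `det ρ = 1`. [cite: GritsenkoHulekSankaran2009, §3 (remark after Prop. 3.3: "similarly for SO, S̃O")] -/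
theorem det_eq_of_eq_prodCongr_refl_trans
    (h : φ = (LinearMap.BilinForm.IsometryEquiv.prodCongr ψ (LinearMap.BilinForm.IsometryEquiv.refl hyperbolicForm)).trans ρ)
    (hρ : LinearMap.det (ρ : V × (Fin 2 → ℤ) →ₗ[ℤ] V × (Fin 2 → ℤ)) = 1) :
    LinearMap.det (φ : V × (Fin 2 → ℤ) →ₗ[ℤ] V × (Fin 2 → ℤ)) = LinearMap.det (ψ : V →ₗ[ℤ] V) := by
  rw [h, det_trans, hρ, one_mul, IsometryEquiv.det_prodCongr_refl]

/-- **`Õ⁺(L) = ⟨E_U(L₁), Õ⁺(L₁)⟩`** (`L = Q ⊕ H`, `Q` symmetric even with a hyperbolic pair, `Q` and `Q ⊕ H`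
non-degenerate): every `φ ∈ Õ⁺(Q ⊕ H)` is `(ψ ⊕ 1) · ρ` with `ρ ∈ S̃O⁺` a product of Eichler
transvections and `ψ ⊕ 1 ∈ Õ⁺`, i.e. `ψ ∈ O⁺(Q)` and `(ψ ⊕ 1)‾ = id`.
[cite: GritsenkoHulekSankaran2009, §3 (remark after Prop. 3.3)] -/
theorem exists_eq_prodCongr_refl_trans_of_congr_eq_refl_of_isOrientationPreserving (hQ : Q.IsSymm) (hev : Q.IsEven)
    (hndQ : Q.Nondegenerate) (hnd : (Q.prod hyperbolicForm).Nondegenerate) {x₁ y₁ : V} (hx₁ : Q x₁ x₁ = 0)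
    (hy₁ : Q y₁ y₁ = 0) (hx₁y₁ : Q x₁ y₁ = 1) (φ : (Q.prod hyperbolicForm).IsometryEquiv (Q.prod hyperbolicForm))
    (hφ₁ : φ.discriminantGroupCongr = LinearEquiv.refl ℤ _) (hφ₂ : φ.IsOrientationPreserving) :
    ∃ (ψ : Q.IsometryEquiv Q) (ρ : (Q.prod hyperbolicForm).IsometryEquiv (Q.prod hyperbolicForm)),
      φ = (LinearMap.BilinForm.IsometryEquiv.prodCongr ψ (LinearMap.BilinForm.IsometryEquiv.refl hyperbolicForm)).trans ρ ∧
      (ρ.discriminantGroupCongr = LinearEquiv.refl ℤ _ ∧ ρ.IsOrientationPreserving ∧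
        LinearMap.det (ρ : V × (Fin 2 → ℤ) →ₗ[ℤ] V × (Fin 2 → ℤ)) = 1) ∧
      (LinearMap.BilinForm.IsometryEquiv.prodCongr ψ (LinearMap.BilinForm.IsometryEquiv.refl hyperbolicForm) :
          (Q.prod hyperbolicForm).IsometryEquiv (Q.prod hyperbolicForm)).discriminantGroupCongr = LinearEquiv.refl ℤ _ ∧
      ψ.IsOrientationPreserving := by
  obtain ⟨ψ, ρ, h, hρ⟩ := exists_eq_prodCongr_refl_trans_of_mem_stableSpecialOrthogonal hQ hev hnd hx₁ hy₁ hx₁y₁ φ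
  exact ⟨ψ, ρ, h, hρ, (discriminantGroupCongr_eq_refl_iff_of_eq_prodCongr_refl_trans h hρ.1).1 hφ₁,
    (isOrientationPreserving_iff_of_eq_prodCongr_refl_trans hQ hndQ hnd h hρ.2.1).1 hφ₂⟩

/-- **`SO⁺(L) = ⟨E_U(L₁), SO⁺(L₁)⟩`**: every `φ ∈ SO⁺(Q ⊕ H)` is `(ψ ⊕ 1) · ρ` with `ρ ∈ S̃O⁺` and `ψ ∈ SO⁺(Q)`.
[cite: GritsenkoHulekSankaran2009, §3 (remark after Prop. 3.3: "similarly for SO")] -/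
theorem exists_eq_prodCongr_refl_trans_of_isOrientationPreserving_of_det_eq_one (hQ : Q.IsSymm) (hev : Q.IsEven)
    (hndQ : Q.Nondegenerate) (hnd : (Q.prod hyperbolicForm).Nondegenerate) {x₁ y₁ : V} (hx₁ : Q x₁ x₁ = 0)
    (hy₁ : Q y₁ y₁ = 0) (hx₁y₁ : Q x₁ y₁ = 1) (φ : (Q.prod hyperbolicForm).IsometryEquiv (Q.prod hyperbolicForm))
    (hφ₁ : φ.IsOrientationPreserving) (hφ₂ : LinearMap.det (φ : V × (Fin 2 → ℤ) →ₗ[ℤ] V × (Fin 2 → ℤ)) = 1) :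
    ∃ (ψ : Q.IsometryEquiv Q) (ρ : (Q.prod hyperbolicForm).IsometryEquiv (Q.prod hyperbolicForm)),
      φ = (LinearMap.BilinForm.IsometryEquiv.prodCongr ψ (LinearMap.BilinForm.IsometryEquiv.refl hyperbolicForm)).trans ρ ∧
      (ρ.discriminantGroupCongr = LinearEquiv.refl ℤ _ ∧ ρ.IsOrientationPreserving ∧
        LinearMap.det (ρ : V × (Fin 2 → ℤ) →ₗ[ℤ] V × (Fin 2 → ℤ)) = 1) ∧
      ψ.IsOrientationPreserving ∧ LinearMap.det (ψ : V →ₗ[ℤ] V) = 1 := by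
  obtain ⟨ψ, ρ, h, hρ⟩ := exists_eq_prodCongr_refl_trans_of_mem_stableSpecialOrthogonal hQ hev hnd hx₁ hy₁ hx₁y₁ φ
  refine ⟨ψ, ρ, h, hρ, (isOrientationPreserving_iff_of_eq_prodCongr_refl_trans hQ hndQ hnd h hρ.2.1).1 hφ₁, ?_⟩
  rw [← det_eq_of_eq_prodCongr_refl_trans h hρ.2.2]
  exact hφ₂

/-- **`S̃O⁺(L) = ⟨E_U(L₁), S̃O⁺(L₁)⟩`**: every `φ ∈ S̃O⁺(Q ⊕ H)` is `(ψ ⊕ 1) · ρ` with `ρ ∈ S̃O⁺` and `ψ ⊕ 1 ∈ S̃O⁺`.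
[cite: GritsenkoHulekSankaran2009, §3 (remark after Prop. 3.3: "similarly for […] S̃O")] -/
theorem exists_eq_prodCongr_refl_trans_of_mem_stableSpecialOrthogonal' (hQ : Q.IsSymm) (hev : Q.IsEven)
    (hnd : (Q.prod hyperbolicForm).Nondegenerate) {x₁ y₁ : V} (hx₁ : Q x₁ x₁ = 0) (hy₁ : Q y₁ y₁ = 0)
    (hx₁y₁ : Q x₁ y₁ = 1) (φ : (Q.prod hyperbolicForm).IsometryEquiv (Q.prod hyperbolicForm))
    (hφ : φ.discriminantGroupCongr = LinearEquiv.refl ℤ _ ∧ φ.IsOrientationPreserving ∧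
      LinearMap.det (φ : V × (Fin 2 → ℤ) →ₗ[ℤ] V × (Fin 2 → ℤ)) = 1) :
    ∃ (ψ : Q.IsometryEquiv Q) (ρ : (Q.prod hyperbolicForm).IsometryEquiv (Q.prod hyperbolicForm)),
      φ = (LinearMap.BilinForm.IsometryEquiv.prodCongr ψ (LinearMap.BilinForm.IsometryEquiv.refl hyperbolicForm)).trans ρ ∧
      (ρ.discriminantGroupCongr = LinearEquiv.refl ℤ _ ∧ ρ.IsOrientationPreserving ∧
        LinearMap.det (ρ : V × (Fin 2 → ℤ) →ₗ[ℤ] V × (Fin 2 → ℤ)) = 1) ∧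
      ((LinearMap.BilinForm.IsometryEquiv.prodCongr ψ (LinearMap.BilinForm.IsometryEquiv.refl hyperbolicForm) :
            (Q.prod hyperbolicForm).IsometryEquiv (Q.prod hyperbolicForm)).discriminantGroupCongr = LinearEquiv.refl ℤ _ ∧
        (LinearMap.BilinForm.IsometryEquiv.prodCongr ψ (LinearMap.BilinForm.IsometryEquiv.refl hyperbolicForm) :
            (Q.prod hyperbolicForm).IsometryEquiv (Q.prod hyperbolicForm)).IsOrientationPreserving ∧
        LinearMap.det ((LinearMap.BilinForm.IsometryEquiv.prodCongr ψ
            (LinearMap.BilinForm.IsometryEquiv.refl hyperbolicForm) :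
          (Q.prod hyperbolicForm).IsometryEquiv (Q.prod hyperbolicForm)) : V × (Fin 2 → ℤ) →ₗ[ℤ] V × (Fin 2 → ℤ)) = 1) := by
  obtain ⟨ψ, ρ, h, hρ⟩ := exists_eq_prodCongr_refl_trans_of_mem_stableSpecialOrthogonal hQ hev hnd hx₁ hy₁ hx₁y₁ φ
  have hB : (Q.prod hyperbolicForm).IsSymm := hQ.prod isSymm_hyperbolicForm
  refine ⟨ψ, ρ, h, hρ, (discriminantGroupCongr_eq_refl_iff_of_eq_prodCongr_refl_trans h hρ.1).1 hφ.1, ?_, ?_⟩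
  · have H := hφ.2.1
    rw [h, LinearMap.BilinForm.IsometryEquiv.isOrientationPreserving_trans_iff hB hnd] at H
    exact H.1 hρ.2.1
  · have H := hφ.2.2
    rwa [h, det_trans, hρ.2.2, one_mul] at H

end Factorisation

/-! ### §4 The conditions on `ψ ⊕ 1` read on `ψ ∈ O(L₁)` itself (`A_{Q ⊕ H} = A_Q`) -/

section OnQ

variable {V : Type u} [AddCommGroup V] [Module.Finite ℤ V] [Module.Free ℤ V] {Q : BilinForm ℤ V}

/-- **`ψ ⊕ 1_H ∈ S̃O⁺(Q ⊕ H) ⟺ ψ ∈ S̃O⁺(Q)`** (`Q` symmetric non-degenerate): `(ψ ⊕ 1)‾ = id ⟺ ψ̄ = id`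
(`A_{Q ⊕ H} = A_Q ⊕ A_H` with `1_H` acting trivially — `LatticeFormsDiscriminantFormIsometryOrthoSum.lean`, row g49-#2),
`ψ ⊕ 1 ∈ O⁺ ⟺ ψ ∈ O⁺` (the Restriction file) and `det (ψ ⊕ 1) = det ψ` (§2).
[cite: GritsenkoHulekSankaran2009, §3 (remark after Prop. 3.3: "similarly for SO, S̃O")] [cite: GritsenkoHulekSankaran2013ModuliK3, §7 Lemma 7.1 (proof)] -/
theorem prodCongr_refl_mem_stableSpecialOrthogonal_iff (hQ : Q.IsSymm) (hndQ : Q.Nondegenerate) (ψ : Q.IsometryEquiv Q) :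
    ((LinearMap.BilinForm.IsometryEquiv.prodCongr ψ (LinearMap.BilinForm.IsometryEquiv.refl hyperbolicForm) :
            (Q.prod hyperbolicForm).IsometryEquiv (Q.prod hyperbolicForm)).discriminantGroupCongr = LinearEquiv.refl ℤ _ ∧
        (LinearMap.BilinForm.IsometryEquiv.prodCongr ψ (LinearMap.BilinForm.IsometryEquiv.refl hyperbolicForm) :
            (Q.prod hyperbolicForm).IsometryEquiv (Q.prod hyperbolicForm)).IsOrientationPreserving ∧
        LinearMap.det ((LinearMap.BilinForm.IsometryEquiv.prodCongr ψ
            (LinearMap.BilinForm.IsometryEquiv.refl hyperbolicForm) :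
          (Q.prod hyperbolicForm).IsometryEquiv (Q.prod hyperbolicForm)) : V × (Fin 2 → ℤ) →ₗ[ℤ] V × (Fin 2 → ℤ)) = 1) ↔
      ψ.discriminantGroupCongr = LinearEquiv.refl ℤ _ ∧ ψ.IsOrientationPreserving ∧ LinearMap.det (ψ : V →ₗ[ℤ] V) = 1 := by
  rw [LinearMap.BilinForm.IsometryEquiv.discriminantGroupCongr_prodCongr_refl_eq_refl_iff,
    LinearMap.BilinForm.IsometryEquiv.isOrientationPreserving_prodCongr_refl_iff hQ hndQ isSymm_hyperbolicForm
      isUnimodular_hyperbolicForm_holds.nondegenerate, IsometryEquiv.det_prodCongr_refl]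

variable {φ ρ : (Q.prod hyperbolicForm).IsometryEquiv (Q.prod hyperbolicForm)} {ψ : Q.IsometryEquiv Q}

omit [Module.Finite ℤ V] [Module.Free ℤ V] in
/-- **`φ̄ = id ⟺ ψ̄ = id`** for `φ = (ψ ⊕ 1) · ρ` with `ρ̄ = id` — the `Õ` clause of "`Õ⁺(L) = ⟨E_U(L₁), Õ⁺(L₁)⟩`" on
`L₁ = Q` itself. [cite: GritsenkoHulekSankaran2009, §3 (remark after Prop. 3.3)] [cite: GritsenkoHulekSankaran2013ModuliK3, §7 Lemma 7.1 (proof)] -/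
theorem discriminantGroupCongr_eq_refl_iff_of_eq_prodCongr_refl_trans'
    (h : φ = (LinearMap.BilinForm.IsometryEquiv.prodCongr ψ (LinearMap.BilinForm.IsometryEquiv.refl hyperbolicForm)).trans ρ)
    (hρ : ρ.discriminantGroupCongr = LinearEquiv.refl ℤ _) :
    φ.discriminantGroupCongr = LinearEquiv.refl ℤ _ ↔ ψ.discriminantGroupCongr = LinearEquiv.refl ℤ _ := by
  rw [discriminantGroupCongr_eq_refl_iff_of_eq_prodCongr_refl_trans h hρ,
    LinearMap.BilinForm.IsometryEquiv.discriminantGroupCongr_prodCongr_refl_eq_refl_iff]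

/-- **`φ ∈ S̃O⁺(Q ⊕ H) ⟺ ψ ∈ S̃O⁺(Q)`** for `φ = (ψ ⊕ 1) · ρ` with `ρ ∈ S̃O⁺(Q ⊕ H)` (`Q` symmetric, `Q` and `Q ⊕ H`
non-degenerate). [cite: GritsenkoHulekSankaran2009, §3 (remark after Prop. 3.3: "similarly for SO, S̃O")] -/
theorem mem_stableSpecialOrthogonal_iff_of_eq_prodCongr_refl_trans (hQ : Q.IsSymm) (hndQ : Q.Nondegenerate)
    (hnd : (Q.prod hyperbolicForm).Nondegenerate)
    (h : φ = (LinearMap.BilinForm.IsometryEquiv.prodCongr ψ (LinearMap.BilinForm.IsometryEquiv.refl hyperbolicForm)).trans ρ)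
    (hρ : ρ.discriminantGroupCongr = LinearEquiv.refl ℤ _ ∧ ρ.IsOrientationPreserving ∧
      LinearMap.det (ρ : V × (Fin 2 → ℤ) →ₗ[ℤ] V × (Fin 2 → ℤ)) = 1) :
    (φ.discriminantGroupCongr = LinearEquiv.refl ℤ _ ∧ φ.IsOrientationPreserving ∧
        LinearMap.det (φ : V × (Fin 2 → ℤ) →ₗ[ℤ] V × (Fin 2 → ℤ)) = 1) ↔
      ψ.discriminantGroupCongr = LinearEquiv.refl ℤ _ ∧ ψ.IsOrientationPreserving ∧ LinearMap.det (ψ : V →ₗ[ℤ] V) = 1 := by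
  rw [discriminantGroupCongr_eq_refl_iff_of_eq_prodCongr_refl_trans' h hρ.1,
    isOrientationPreserving_iff_of_eq_prodCongr_refl_trans hQ hndQ hnd h hρ.2.1, det_eq_of_eq_prodCongr_refl_trans h hρ.2.2]

/-- **`Õ⁺(L) = ⟨E_U(L₁), Õ⁺(L₁)⟩` with the conditions on `L₁ = Q`** (`Q` symmetric even with a hyperbolic pair, `Q` and
`Q ⊕ H` non-degenerate): every `φ ∈ Õ⁺(Q ⊕ H)` is `(ψ ⊕ 1) · ρ` with `ρ ∈ S̃O⁺` a product of Eichler transvections and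
`ψ ∈ Õ⁺(Q)`, i.e. `ψ̄ = id` on `A_Q` and `ψ ∈ O⁺(Q)`. [cite: GritsenkoHulekSankaran2009, §3 (remark after Prop. 3.3)] -/
theorem exists_eq_prodCongr_refl_trans_of_congr_eq_refl_of_isOrientationPreserving' (hQ : Q.IsSymm) (hev : Q.IsEven)
    (hndQ : Q.Nondegenerate) (hnd : (Q.prod hyperbolicForm).Nondegenerate) {x₁ y₁ : V} (hx₁ : Q x₁ x₁ = 0)
    (hy₁ : Q y₁ y₁ = 0) (hx₁y₁ : Q x₁ y₁ = 1) (φ : (Q.prod hyperbolicForm).IsometryEquiv (Q.prod hyperbolicForm))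
    (hφ₁ : φ.discriminantGroupCongr = LinearEquiv.refl ℤ _) (hφ₂ : φ.IsOrientationPreserving) :
    ∃ (ψ : Q.IsometryEquiv Q) (ρ : (Q.prod hyperbolicForm).IsometryEquiv (Q.prod hyperbolicForm)),
      φ = (LinearMap.BilinForm.IsometryEquiv.prodCongr ψ (LinearMap.BilinForm.IsometryEquiv.refl hyperbolicForm)).trans ρ ∧
      (ρ.discriminantGroupCongr = LinearEquiv.refl ℤ _ ∧ ρ.IsOrientationPreserving ∧
        LinearMap.det (ρ : V × (Fin 2 → ℤ) →ₗ[ℤ] V × (Fin 2 → ℤ)) = 1) ∧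
      ψ.discriminantGroupCongr = LinearEquiv.refl ℤ _ ∧ ψ.IsOrientationPreserving := by
  obtain ⟨ψ, ρ, h, hρ, hψ₁, hψ₂⟩ :=
    exists_eq_prodCongr_refl_trans_of_congr_eq_refl_of_isOrientationPreserving hQ hev hndQ hnd hx₁ hy₁ hx₁y₁ φ hφ₁ hφ₂
  exact ⟨ψ, ρ, h, hρ, (LinearMap.BilinForm.IsometryEquiv.discriminantGroupCongr_prodCongr_refl_eq_refl_iff ψ).1 hψ₁, hψ₂⟩

/-- **`S̃O⁺(L) = ⟨E_U(L₁), S̃O⁺(L₁)⟩` with the conditions on `L₁ = Q`**: every `φ ∈ S̃O⁺(Q ⊕ H)` is `(ψ ⊕ 1) · ρ` with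
`ρ ∈ S̃O⁺` and `ψ ∈ S̃O⁺(Q)`. [cite: GritsenkoHulekSankaran2009, §3 (remark after Prop. 3.3: "similarly for […] S̃O")] -/
theorem exists_eq_prodCongr_refl_trans_of_mem_stableSpecialOrthogonal'' (hQ : Q.IsSymm) (hev : Q.IsEven)
    (hndQ : Q.Nondegenerate) (hnd : (Q.prod hyperbolicForm).Nondegenerate) {x₁ y₁ : V} (hx₁ : Q x₁ x₁ = 0)
    (hy₁ : Q y₁ y₁ = 0) (hx₁y₁ : Q x₁ y₁ = 1) (φ : (Q.prod hyperbolicForm).IsometryEquiv (Q.prod hyperbolicForm))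
    (hφ : φ.discriminantGroupCongr = LinearEquiv.refl ℤ _ ∧ φ.IsOrientationPreserving ∧
      LinearMap.det (φ : V × (Fin 2 → ℤ) →ₗ[ℤ] V × (Fin 2 → ℤ)) = 1) :
    ∃ (ψ : Q.IsometryEquiv Q) (ρ : (Q.prod hyperbolicForm).IsometryEquiv (Q.prod hyperbolicForm)),
      φ = (LinearMap.BilinForm.IsometryEquiv.prodCongr ψ (LinearMap.BilinForm.IsometryEquiv.refl hyperbolicForm)).trans ρ ∧
      (ρ.discriminantGroupCongr = LinearEquiv.refl ℤ _ ∧ ρ.IsOrientationPreserving ∧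
        LinearMap.det (ρ : V × (Fin 2 → ℤ) →ₗ[ℤ] V × (Fin 2 → ℤ)) = 1) ∧
      (ψ.discriminantGroupCongr = LinearEquiv.refl ℤ _ ∧ ψ.IsOrientationPreserving ∧
        LinearMap.det (ψ : V →ₗ[ℤ] V) = 1) := by
  obtain ⟨ψ, ρ, h, hρ⟩ := exists_eq_prodCongr_refl_trans_of_mem_stableSpecialOrthogonal hQ hev hnd hx₁ hy₁ hx₁y₁ φ
  exact ⟨ψ, ρ, h, hρ, (mem_stableSpecialOrthogonal_iff_of_eq_prodCongr_refl_trans hQ hndQ hnd h hρ).1 hφ⟩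

/-- Conversely **`(ψ ⊕ 1) · ρ ∈ Õ⁺(Q ⊕ H)`** for `ψ ∈ Õ⁺(Q)` and `ρ ∈ S̃O⁺(Q ⊕ H)` ("`⟨E_U(L₁), Õ⁺(L₁)⟩ ⊆ Õ⁺(L)`").
[cite: GritsenkoHulekSankaran2009, §3 (remark after Prop. 3.3)] -/
theorem congr_eq_refl_and_isOrientationPreserving_prodCongr_refl_trans (hQ : Q.IsSymm) (hndQ : Q.Nondegenerate)
    (hnd : (Q.prod hyperbolicForm).Nondegenerate) (ψ : Q.IsometryEquiv Q)
    (hψ₁ : ψ.discriminantGroupCongr = LinearEquiv.refl ℤ _) (hψ₂ : ψ.IsOrientationPreserving)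
    (ρ : (Q.prod hyperbolicForm).IsometryEquiv (Q.prod hyperbolicForm))
    (hρ : ρ.discriminantGroupCongr = LinearEquiv.refl ℤ _ ∧ ρ.IsOrientationPreserving ∧
      LinearMap.det (ρ : V × (Fin 2 → ℤ) →ₗ[ℤ] V × (Fin 2 → ℤ)) = 1) :
    ((LinearMap.BilinForm.IsometryEquiv.prodCongr ψ (LinearMap.BilinForm.IsometryEquiv.refl hyperbolicForm)).trans ρ :
          (Q.prod hyperbolicForm).IsometryEquiv (Q.prod hyperbolicForm)).discriminantGroupCongr = LinearEquiv.refl ℤ _ ∧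
      ((LinearMap.BilinForm.IsometryEquiv.prodCongr ψ (LinearMap.BilinForm.IsometryEquiv.refl hyperbolicForm)).trans ρ :
          (Q.prod hyperbolicForm).IsometryEquiv (Q.prod hyperbolicForm)).IsOrientationPreserving :=
  ⟨(discriminantGroupCongr_eq_refl_iff_of_eq_prodCongr_refl_trans' rfl hρ.1).2 hψ₁,
    (isOrientationPreserving_iff_of_eq_prodCongr_refl_trans hQ hndQ hnd rfl hρ.2.1).2 hψ₂⟩

/-- Conversely **`(ψ ⊕ 1) · ρ ∈ S̃O⁺(Q ⊕ H)`** for `ψ ∈ S̃O⁺(Q)` and `ρ ∈ S̃O⁺(Q ⊕ H)`.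
[cite: GritsenkoHulekSankaran2009, §3 (remark after Prop. 3.3)] -/
theorem prodCongr_refl_trans_mem_stableSpecialOrthogonal (hQ : Q.IsSymm) (hndQ : Q.Nondegenerate)
    (hnd : (Q.prod hyperbolicForm).Nondegenerate) (ψ : Q.IsometryEquiv Q)
    (hψ : ψ.discriminantGroupCongr = LinearEquiv.refl ℤ _ ∧ ψ.IsOrientationPreserving ∧ LinearMap.det (ψ : V →ₗ[ℤ] V) = 1)
    (ρ : (Q.prod hyperbolicForm).IsometryEquiv (Q.prod hyperbolicForm))
    (hρ : ρ.discriminantGroupCongr = LinearEquiv.refl ℤ _ ∧ ρ.IsOrientationPreserving ∧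
      LinearMap.det (ρ : V × (Fin 2 → ℤ) →ₗ[ℤ] V × (Fin 2 → ℤ)) = 1) :
    ((LinearMap.BilinForm.IsometryEquiv.prodCongr ψ (LinearMap.BilinForm.IsometryEquiv.refl hyperbolicForm)).trans ρ :
          (Q.prod hyperbolicForm).IsometryEquiv (Q.prod hyperbolicForm)).discriminantGroupCongr = LinearEquiv.refl ℤ _ ∧
      ((LinearMap.BilinForm.IsometryEquiv.prodCongr ψ (LinearMap.BilinForm.IsometryEquiv.refl hyperbolicForm)).trans ρ :
          (Q.prod hyperbolicForm).IsometryEquiv (Q.prod hyperbolicForm)).IsOrientationPreserving ∧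
      LinearMap.det (((LinearMap.BilinForm.IsometryEquiv.prodCongr ψ
          (LinearMap.BilinForm.IsometryEquiv.refl hyperbolicForm)).trans ρ :
          (Q.prod hyperbolicForm).IsometryEquiv (Q.prod hyperbolicForm)) : V × (Fin 2 → ℤ) →ₗ[ℤ] V × (Fin 2 → ℤ)) = 1 :=
  (mem_stableSpecialOrthogonal_iff_of_eq_prodCongr_refl_trans hQ hndQ hnd rfl hρ).2 hψ

end OnQ

end Literature.Topology.FourManifolds
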